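import Summits.BirchSwinnertonDyer.BirchSwinnertonDyer.Theorems.EisensteinPrimesBSDpOnCellCTelescopeK2PurityOfPTorsionPseudoNull
import Literature.NumberTheory.IwasawaTheory.Greenberg2006.AlmostDivisibilityCriterion
import Mathlib.Algebra.Module.CharacterModule
import HarnessLib

/-!
# Crux 4 `BSDpOnCellC` (stmt-BirchSwinnertonDyer-19034), line «telescope», sub-leaf W4 of leaf N2, node W4⁰
# (`K2Weight2.stub_bigPseudoNullPTorsion`, «`p`-tolerant no-pseudo-null») — route G′, part 1: tolerance from an
# ALMOST-DIVISIBLE CORE (pure algebra over Greenberg's dual dictionary; ideator bsd-idea-12 g39; `--supports`,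
# helper; closes nothing)

Context. The workfile `Cruxes/BSDpOnCellC/Lines/telescopeK2weight2.lean` v1.2 reduces sub-leaf W4 (purity) of the
weight-two leaf N2 to W2 ∧ W3 ∧ W4⁰, where W4⁰ (`K2Weight2.stub_bigPseudoNullPTorsion`) says: every pseudo-null
`B`-submodule of `X₂ = XBig κ ρ₂ 𝔭̄ ∅ = CharacterModule (selmerBig …)` is killed by a power of `p`
(`B = ℤ_p⟦X⟧⟦T⟧`). The memo `Cruxes/BSDpOnCellC/W-PRICING-n2.md` §W4-G′ proposes to get W4⁰ from
Greenberg 2016 Prop. 4.1.1 (c) applied NOT to the Selmer group `S_𝓛` itself (whose local conditions at the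
bad places need not be almost divisible) but to an almost-divisible CORE `S_{𝓛'} ≤ S_𝓛` with `p^a S_𝓛 ≤ S_{𝓛'}`
(`𝓛'_w = p^a 𝓛_w` at `w ∣ N`, `𝓛'_v = 𝓛_v` elsewhere). This file supplies the model-free algebra of that step,
over an arbitrary commutative ring `Λ` (the companion part 2, `…TelescopeK2PurityCoreAtBadPrimes`, certifies the
cores `p^a 𝓛_w`):

* §1 plumbing for Greenberg's dictionary (`IsDualPairing`, `HasNoPseudoNullSubmodule`, `IsAlmostDivisible`):
  "no non-zero pseudo-null submodule" descends along injections / isomorphisms, and almost divisibility is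
  read on the ONE dual `CharacterModule S` (`isAlmostDivisible_iff_hasNoPseudoNullSubmodule_characterModule`);
* §2 **tolerance from a core** (`forall_isPseudoNull_smul_eq_zero_of_core`, `…_of_le`, `…exists_pow…`): if
  `ι : S' ↪ S` is `Λ`-linear, `r • S ⊆ ι(S')` and `S'` is almost divisible, then in EVERY Pontryagin dual `X`
  of `S` every pseudo-null submodule is killed by `r`. Proof: `K = ker(X = Ŝ → Ŝ')` is the dual of `S/ι(S')`,
  hence killed by `r`; `X/K ≅ Ŝ'` (characters extend along injections: Mathlib
  `CharacterModule.dual_surjective_of_injective`) has no non-zero pseudo-null submodule; then the extension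
  principle `TelescopeK2PurityOfPTorsionPseudoNull.forall_isPseudoNull_pow_smul_eq_zero_of_quotient` (p754825);
* §3 **almost divisibility of `r • L` is read on `r • L̂`** (`isAlmostDivisible_range_lsmul_of_hasNoPseudoNullSubmodule`,
  `isAlmostDivisible_map_lsmul_of_hasNoPseudoNullSubmodule`): the dual of `rL` is `r L̂ ≤ L̂`
  (`range_dual_rangeRestrict_lsmul`: a character of `rL` extends to `L`), so `rL` is almost divisible as soon as
  `r L̂` has no non-zero pseudo-null submodule — the shape in which the cores `p^a · L(K_w, 𝐃)` at the places
  `w ∣ N` are certified in part 2 (their duals sit inside `p^a · (𝐃^{I_w})^∨`); and `r M̂ = Ann(M[r])`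
  (`mem_range_lsmul_characterModule_iff`) with its two corollaries: `t` is a non-zero-divisor on `M̂` (resp. on
  `M̂ / r M̂`) when `M` (resp. `M[r]`) is `t`-divisible;
* §4 the **Selmer-group instance** in Greenberg's arena (`Specification`): `S_{𝓛'} ≤ S_𝓛` when `𝓛' ≤ 𝓛`
  (`selmer_mono`), `r • S_𝓛 ≤ S_{𝓛'}` when `r • L_v ≤ L'_v` at every `v ∈ Σ` (`smul_mem_selmer_of_forall`), and
  the packaged statement `forall_isPseudoNull_smul_eq_zero_selmer_of_core`: granted `IsAlmostDivisible Λ S_{𝓛'}`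
  (the CONCLUSION of Prop. 4.1.1 (c) for `𝓛'`, tree TC theorem
  `Greenberg2016.selmer_isAlmostDivisible_caseC_of_prop`), every pseudo-null submodule of every dual of `S_𝓛`
  is killed by `r`.

HONESTY. Pure algebra; nothing here proves W4⁰, W4, N2, the crux `BSDpOnCellC` or any summit statement; the
remaining content of route G′ (the hypotheses of Prop. 4.1.1 (c) for the core specification, and the local model
`𝐃^{I_w} ↠ L(K_w, 𝐃)` with its two `T`-divisibilities at `w ∣ N`) is displayed, not claimed. BSD is proved for no
curve. AI-typed, kernel-checked; theorems only (no `def`, no instance, no named fact, no `sorry`).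

[cite: Greenberg2016Selmer, §1 p. 2 L17–35 (duals, almost divisibility), Remark 3.1.2, Prop. 4.1.1 (c), §4.2 p. 19 L25–31]
[cite: Greenberg2006, Prop. 2.4 (pp. 350–351)] [cite: BourbakiAC5to7, Ch. VII §4 no. 4]
-/

set_option autoImplicit false
-- D-0017: single-problem summit, the namespace repeats the problem name by design.
set_option linter.dupNamespace false

noncomputable section

open scoped Classical
open NumberField IsDedekindDomain
open Literature.NumberTheory.GaloisRepresentations
open Literature.NumberTheory.IwasawaTheory.Greenberg2016
open Literature.NumberTheory.IwasawaTheory.Greenberg2006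
open Literature.NumberTheory.EllipticCurves (Module.IsPseudoNull)

universe u

namespace Summit.BirchSwinnertonDyer.BirchSwinnertonDyer.Theorems.TelescopeK2PurityTolerantOfCore

/-! ## §1 Plumbing for the dual dictionary -/

section Plumbing

variable {Λ : Type u} [CommRing Λ] {X X' : Type u} [AddCommGroup X] [Module Λ X] [AddCommGroup X']
  [Module Λ X']

/-- "No non-zero pseudo-null submodule" descends along an injective `Λ`-linear map.
[cite: BourbakiAC5to7, Ch. VII §4 no. 4] [cite: Greenberg2016Selmer, §1 p. 2 L31–35] -/
theorem hasNoPseudoNullSubmodule_of_injective (g : X' →ₗ[Λ] X) (hg : Function.Injective g)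
    (h : HasNoPseudoNullSubmodule Λ X) : HasNoPseudoNullSubmodule Λ X' := by
  intro N hN
  have hNg : Module.IsPseudoNull Λ ↥(N.map g) :=
    hN.of_linearEquiv (Submodule.equivMapOfInjective g hg N)
  have h0 := h _ hNg
  rw [Submodule.eq_bot_iff] at h0 ⊢
  intro x hx
  exact hg (by rw [map_zero]; exact h0 _ (Submodule.mem_map_of_mem hx))

/-- "No non-zero pseudo-null submodule" transports along a `Λ`-linear isomorphism.
[cite: BourbakiAC5to7, Ch. VII §4 no. 4] -/
theorem hasNoPseudoNullSubmodule_of_linearEquiv (e : X ≃ₗ[Λ] X') (h : HasNoPseudoNullSubmodule Λ X) :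
    HasNoPseudoNullSubmodule Λ X' :=
  hasNoPseudoNullSubmodule_of_injective e.symm.toLinearMap e.symm.injective h

/-- **Almost divisibility is read on ONE dual**: `S` is almost divisible (every dual datum has no non-zero
pseudo-null submodule) iff Mathlib's `CharacterModule S` has none (two duals are isomorphic `Λ`-modules,
`IsDualPairing.linearEquiv`). [cite: Greenberg2016Selmer, §1 p. 2 L17–35] [cite: Greenberg2006, Prop. 2.4] -/
theorem isAlmostDivisible_iff_hasNoPseudoNullSubmodule_characterModule {S : Type u} [AddCommGroup S]
    [Module Λ S] : IsAlmostDivisible Λ S ↔ HasNoPseudoNullSubmodule Λ (CharacterModule S) := by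
  refine ⟨fun h ↦ h _ _ (isDualPairing_characterModule Λ S), fun h X _ _ toDual hX ↦ ?_⟩
  exact hasNoPseudoNullSubmodule_of_linearEquiv ((isDualPairing_characterModule Λ S).linearEquiv hX) h

/-- Membership in `r • V`, written as the range of `LinearMap.lsmul Λ V r`. [folklore] -/
theorem mem_range_lsmul_iff {V : Type*} [AddCommGroup V] [Module Λ V] (r : Λ) (x : V) :
    x ∈ LinearMap.range (LinearMap.lsmul Λ V r) ↔ ∃ y : V, r • y = x := by
  simp [LinearMap.mem_range]

/-- `r • X'` embeds in `r • X` along an injective `g : X' → X`; hence "no non-zero pseudo-null submodule"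
descends from `r • X` to `r • X'`. [cite: BourbakiAC5to7, Ch. VII §4 no. 4] -/
theorem hasNoPseudoNullSubmodule_range_lsmul_of_injective (g : X' →ₗ[Λ] X) (hg : Function.Injective g)
    (r : Λ) (h : HasNoPseudoNullSubmodule Λ ↥(LinearMap.range (LinearMap.lsmul Λ X r))) :
    HasNoPseudoNullSubmodule Λ ↥(LinearMap.range (LinearMap.lsmul Λ X' r)) := by
  have hmap : ∀ x ∈ LinearMap.range (LinearMap.lsmul Λ X' r),
      g x ∈ LinearMap.range (LinearMap.lsmul Λ X r) := by
    intro x hx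
    obtain ⟨y, rfl⟩ := (mem_range_lsmul_iff r x).mp hx
    exact (mem_range_lsmul_iff r _).mpr ⟨g y, (map_smul g r y).symm⟩
  refine hasNoPseudoNullSubmodule_of_injective (g.restrict hmap) ?_ h
  intro x y hxy
  exact Subtype.ext (hg (congr_arg Subtype.val hxy))

end Plumbing

/-! ## §2 Tolerance from an almost-divisible core -/

section Core

variable {Λ : Type u} [CommRing Λ] {S' S : Type u} [AddCommGroup S'] [Module Λ S'] [AddCommGroup S]
  [Module Λ S]

/-- The kernel of `Ŝ → Ŝ'` (restriction of characters along `ι : S' → S`) is killed by `r` as soon as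
`r • S ⊆ ι(S')`: `(r • x)(s) = x(r • s) = x(ι s') = 0`. [cite: Greenberg2016Selmer, §1 p. 2 L17–35] -/
theorem smul_eq_zero_of_mem_ker_dual (ι : S' →ₗ[Λ] S) {r : Λ}
    (hr : ∀ s : S, r • s ∈ LinearMap.range ι) {x : CharacterModule S}
    (hx : x ∈ LinearMap.ker (CharacterModule.dual ι)) : r • x = 0 := by
  rw [LinearMap.mem_ker] at hx
  ext s
  obtain ⟨s', hs'⟩ := hr s
  have h1 : x (ι s') = 0 := DFunLike.congr_fun hx s'
  rw [CharacterModule.smul_apply, ← hs', h1]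
  rfl

/-- **Tolerance from a core, for the canonical dual.** `ι : S' ↪ S` injective `Λ`-linear, `r • S ⊆ ι(S')`,
`S'` almost divisible ⟹ every pseudo-null `Λ`-submodule of `Ŝ = CharacterModule S` is killed by `r`.
(`K = ker(Ŝ → Ŝ')` is killed by `r`; `Ŝ/K ≅ Ŝ'` by `CharacterModule.dual_surjective_of_injective`; extension
principle.) [cite: Greenberg2016Selmer, Remark 3.1.2, §4.2 p. 19 L25–31] [cite: BourbakiAC5to7, Ch. VII §4 no. 4] -/
theorem forall_isPseudoNull_smul_eq_zero_characterModule_of_core (ι : S' →ₗ[Λ] S)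
    (hι : Function.Injective ι) {r : Λ} (hr : ∀ s : S, r • s ∈ LinearMap.range ι)
    (hS' : IsAlmostDivisible Λ S') :
    ∀ P : Submodule Λ (CharacterModule S), Module.IsPseudoNull Λ ↥P → ∀ x ∈ P, r • x = 0 := by
  intro P hP x hx
  have hK : ∀ y ∈ LinearMap.ker (CharacterModule.dual ι), r ^ 1 • y = 0 := fun y hy ↦ by
    rw [pow_one]; exact smul_eq_zero_of_mem_ker_dual ι hr hy
  let e : (CharacterModule S ⧸ LinearMap.ker (CharacterModule.dual ι)) ≃ₗ[Λ] CharacterModule S' :=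
    LinearMap.quotKerEquivOfSurjective _ (CharacterModule.dual_surjective_of_injective ι hι)
  have hQ : ∀ Q : Submodule Λ (CharacterModule S ⧸ LinearMap.ker (CharacterModule.dual ι)),
      Module.IsPseudoNull Λ ↥Q → Q = ⊥ :=
    hasNoPseudoNullSubmodule_of_linearEquiv e.symm
      (isAlmostDivisible_iff_hasNoPseudoNullSubmodule_characterModule.mp hS')
  have h := TelescopeK2PurityOfPTorsionPseudoNull.forall_isPseudoNull_pow_smul_eq_zero_of_quotient
    (LinearMap.ker (CharacterModule.dual ι)) hK hQ P hP x hx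
  rwa [pow_one] at h

/-- **Tolerance from a core, for every dual datum** (Greenberg's dictionary: any `X` with
`IsDualPairing Λ S toDual`). [cite: Greenberg2016Selmer, §1 p. 2 L17–35, Remark 3.1.2] -/
theorem forall_isPseudoNull_smul_eq_zero_of_core (ι : S' →ₗ[Λ] S) (hι : Function.Injective ι) {r : Λ}
    (hr : ∀ s : S, r • s ∈ LinearMap.range ι) (hS' : IsAlmostDivisible Λ S') {X : Type u}
    [AddCommGroup X] [Module Λ X] {toDual : X →+ (S →+ AddCircle (1 : ℚ))}
    (hX : IsDualPairing Λ S toDual) :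
    ∀ P : Submodule Λ X, Module.IsPseudoNull Λ ↥P → ∀ x ∈ P, r • x = 0 := by
  intro P hP x hx
  let e : X ≃ₗ[Λ] CharacterModule S := hX.linearEquiv (isDualPairing_characterModule Λ S)
  have hPe : Module.IsPseudoNull Λ ↥(P.map e.toLinearMap) :=
    hP.of_linearEquiv (Submodule.equivMapOfInjective e.toLinearMap e.injective P)
  have h0 := forall_isPseudoNull_smul_eq_zero_characterModule_of_core ι hι hr hS' _ hPe (e x)
    (Submodule.mem_map_of_mem (f := e.toLinearMap) hx)
  rw [← map_smul, LinearEquiv.map_eq_zero_iff] at h0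
  exact h0

variable {H : Type u} [AddCommGroup H] [Module Λ H] {T' T : Submodule Λ H}

/-- **Tolerance from a core, submodule form**: `T' ≤ T ≤ H`, `r • T ⊆ T'`, `T'` almost divisible ⟹ in every
dual of `T` every pseudo-null submodule is killed by `r` — the shape `S_{𝓛'} ≤ S_𝓛 ≤ H¹(K_Σ/K, 𝐃)`.
[cite: Greenberg2016Selmer, Remark 3.1.2, §4.2 p. 19 L25–31] -/
theorem forall_isPseudoNull_smul_eq_zero_of_le (hle : T' ≤ T) {r : Λ} (hr : ∀ s ∈ T, r • s ∈ T')
    (hT' : IsAlmostDivisible Λ ↥T') {X : Type u} [AddCommGroup X] [Module Λ X]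
    {toDual : X →+ (↥T →+ AddCircle (1 : ℚ))} (hX : IsDualPairing Λ ↥T toDual) :
    ∀ P : Submodule Λ X, Module.IsPseudoNull Λ ↥P → ∀ x ∈ P, r • x = 0 :=
  forall_isPseudoNull_smul_eq_zero_of_core (Submodule.inclusion hle) (Submodule.inclusion_injective hle)
    (fun s ↦ ⟨⟨r • (s : H), hr s s.2⟩, Subtype.ext rfl⟩) hT' hX

/-- The same in the TOLERANT shape of `K2Weight2.stub_bigPseudoNullPTorsion` (`∃ m` per submodule): with
`c ^ a • T ⊆ T'`, every pseudo-null submodule of every dual of `T` is killed by some power of `c`.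
[cite: Greenberg2016Selmer, Remark 3.1.2] [cite: BourbakiAC5to7, Ch. VII §4 no. 4] -/
theorem forall_isPseudoNull_exists_pow_smul_eq_zero_of_le (hle : T' ≤ T) (c : Λ) (a : ℕ)
    (hr : ∀ s ∈ T, c ^ a • s ∈ T') (hT' : IsAlmostDivisible Λ ↥T') {X : Type u} [AddCommGroup X]
    [Module Λ X] {toDual : X →+ (↥T →+ AddCircle (1 : ℚ))} (hX : IsDualPairing Λ ↥T toDual) :
    ∀ P : Submodule Λ X, Module.IsPseudoNull Λ ↥P → ∃ m : ℕ, ∀ x ∈ P, c ^ m • x = 0 :=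
  fun P hP ↦ ⟨a, forall_isPseudoNull_smul_eq_zero_of_le hle hr hT' hX P hP⟩

/-- The tolerant shape for the canonical dual `CharacterModule ↥T` (the `XBig = CharacterModule (selmerBig …)`
reading of W4⁰). [cite: Greenberg2016Selmer, Remark 3.1.2] -/
theorem forall_isPseudoNull_exists_pow_smul_eq_zero_characterModule_of_le (hle : T' ≤ T) (c : Λ) (a : ℕ)
    (hr : ∀ s ∈ T, c ^ a • s ∈ T') (hT' : IsAlmostDivisible Λ ↥T') :
    ∀ P : Submodule Λ (CharacterModule ↥T), Module.IsPseudoNull Λ ↥P →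
      ∃ m : ℕ, ∀ x ∈ P, c ^ m • x = 0 :=
  forall_isPseudoNull_exists_pow_smul_eq_zero_of_le hle c a hr hT' (isDualPairing_characterModule Λ ↥T)

end Core

/-! ## §3 Almost divisibility of `r • L` is read on `r • L̂` -/

section SmulCore

variable {Λ : Type u} [CommRing Λ] {L : Type u} [AddCommGroup L] [Module Λ L]

/-- **The dual of `rL` is `r L̂`**: the (injective) restriction of characters along `L ↠ rL` has range exactly
`r • CharacterModule L` (a character of `rL ≤ L` extends to `L` — `ℚ/ℤ` is divisible —, and
`x̃ ∘ (r ·) = r • x̃`). [cite: Greenberg2016Selmer, §1 p. 2 L17–35] [cite: Greenberg2006, p. 350 L25–36] -/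
theorem range_dual_rangeRestrict_lsmul (r : Λ) :
    LinearMap.range (CharacterModule.dual (LinearMap.lsmul Λ L r).rangeRestrict) =
      LinearMap.range (LinearMap.lsmul Λ (CharacterModule L) r) := by
  ext x
  constructor
  · rintro ⟨y, rfl⟩
    obtain ⟨z, hz⟩ := CharacterModule.dual_surjective_of_injective
      (LinearMap.range (LinearMap.lsmul Λ L r)).subtype (Submodule.injective_subtype _) y
    refine ⟨z, ?_⟩
    rw [← hz]
    ext l
    rfl
  · rintro ⟨z, rfl⟩
    refine ⟨CharacterModule.dual (LinearMap.range (LinearMap.lsmul Λ L r)).subtype z, ?_⟩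
    ext l
    rfl

/-- **`rL` is almost divisible as soon as `r L̂` has no non-zero pseudo-null submodule** (`L̂ = CharacterModule L`).
[cite: Greenberg2016Selmer, §1 p. 2 L17–35] [cite: Greenberg2006, Prop. 2.4] -/
theorem isAlmostDivisible_range_lsmul_of_hasNoPseudoNullSubmodule (r : Λ)
    (h : HasNoPseudoNullSubmodule Λ ↥(LinearMap.range (LinearMap.lsmul Λ (CharacterModule L) r))) :
    IsAlmostDivisible Λ ↥(LinearMap.range (LinearMap.lsmul Λ L r)) := by
  rw [isAlmostDivisible_iff_hasNoPseudoNullSubmodule_characterModule]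
  have hinj : Function.Injective (CharacterModule.dual (LinearMap.lsmul Λ L r).rangeRestrict) :=
    CharacterModule.dual_injective_of_surjective _ (LinearMap.surjective_rangeRestrict _)
  let e₁ := LinearEquiv.ofInjective _ hinj
  let e₂ := LinearEquiv.ofEq _ _ (range_dual_rangeRestrict_lsmul (L := L) r)
  exact hasNoPseudoNullSubmodule_of_linearEquiv (e₁.trans e₂).symm h

/-- The same with the hypothesis placed on ANY dual datum `X` of `L` (`r • X` has no non-zero pseudo-null
submodule). [cite: Greenberg2016Selmer, §1 p. 2 L17–35] -/
theorem isAlmostDivisible_range_lsmul_of_isDualPairing (r : Λ) {X : Type u} [AddCommGroup X] [Module Λ X]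
    {toDual : X →+ (L →+ AddCircle (1 : ℚ))} (hX : IsDualPairing Λ L toDual)
    (h : HasNoPseudoNullSubmodule Λ ↥(LinearMap.range (LinearMap.lsmul Λ X r))) :
    IsAlmostDivisible Λ ↥(LinearMap.range (LinearMap.lsmul Λ L r)) :=
  isAlmostDivisible_range_lsmul_of_hasNoPseudoNullSubmodule r
    (hasNoPseudoNullSubmodule_range_lsmul_of_injective
      ((isDualPairing_characterModule Λ L).linearEquiv hX).toLinearMap
      ((isDualPairing_characterModule Λ L).linearEquiv hX).injective r h)

/-- **Submodule form** (the local conditions `L(K_w, 𝐃) ≤ H¹(K_w, 𝐃)`): for `N ≤ H`, the submodule `r • N`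
(`N.map (lsmul r)`) is almost divisible as soon as `r • N̂` has no non-zero pseudo-null submodule.
[cite: Greenberg2016Selmer, §2.5 p. 8 L35–37, §4.2 p. 19 L25–31] -/
theorem isAlmostDivisible_map_lsmul_of_hasNoPseudoNullSubmodule {H : Type u} [AddCommGroup H] [Module Λ H]
    (N : Submodule Λ H) (r : Λ)
    (h : HasNoPseudoNullSubmodule Λ ↥(LinearMap.range (LinearMap.lsmul Λ (CharacterModule ↥N) r))) :
    IsAlmostDivisible Λ ↥(N.map (LinearMap.lsmul Λ H r)) := by
  have h1 := (isAlmostDivisible_range_lsmul_of_hasNoPseudoNullSubmodule r h).range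
    (N.subtype ∘ₗ (LinearMap.range (LinearMap.lsmul Λ (↥N) r)).subtype)
  have heq : LinearMap.range (N.subtype ∘ₗ (LinearMap.range (LinearMap.lsmul Λ (↥N) r)).subtype) =
      N.map (LinearMap.lsmul Λ H r) := by
    ext x
    simp only [LinearMap.mem_range, LinearMap.coe_comp, Function.comp_apply, Submodule.coe_subtype,
      Submodule.mem_map, LinearMap.lsmul_apply]
    constructor
    · rintro ⟨⟨y, hy⟩, rfl⟩
      obtain ⟨n, rfl⟩ := (mem_range_lsmul_iff r y).mp hy
      exact ⟨n, n.2, by simp⟩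
    · rintro ⟨n, hn, rfl⟩
      exact ⟨⟨r • ⟨n, hn⟩, (mem_range_lsmul_iff r _).mpr ⟨⟨n, hn⟩, rfl⟩⟩, by simp⟩
  exact h1.of_surjective (LinearEquiv.ofEq _ _ heq).toLinearMap (LinearEquiv.ofEq _ _ heq).surjective

/-- **`r • M̂` is the annihilator of `M[r]`**: a character `y` of `M` is `r` times a character iff it kills the
`r`-torsion (⟸: `y` descends to `rM ≅ M/M[r]`, extends to `M` by divisibility of `ℚ/ℤ`, and `y = r • ỹ`).
[cite: Greenberg2006, p. 350 L25–36 ("`X[P] ≠ 0` iff `PA ≠ A`")] [cite: Greenberg2016Selmer, §1 p. 2 L17–35] -/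
theorem mem_range_lsmul_characterModule_iff {M : Type u} [AddCommGroup M] [Module Λ M] (r : Λ)
    (y : CharacterModule M) :
    y ∈ LinearMap.range (LinearMap.lsmul Λ (CharacterModule M) r) ↔ ∀ m : M, r • m = 0 → y m = 0 := by
  constructor
  · rintro ⟨z, rfl⟩ m hm
    rw [LinearMap.lsmul_apply, CharacterModule.smul_apply, hm, map_zero]
  · intro hy
    have hpre : ∀ x : ↥(LinearMap.range (LinearMap.lsmul Λ M r)), ∃ m : M, r • m = x := fun x ↦
      (mem_range_lsmul_iff r (x : M)).mp x.2
    choose pre hpre using hpre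
    have hdiff : ∀ m m' : M, r • m = r • m' → y m = y m' := by
      intro m m' h
      have h0 : y (m - m') = 0 := hy _ (by rw [smul_sub, h, sub_self])
      rwa [map_sub, sub_eq_zero] at h0
    let y' : CharacterModule ↥(LinearMap.range (LinearMap.lsmul Λ M r)) :=
      AddMonoidHom.mk' (fun x ↦ y (pre x)) (fun a b ↦ by
        rw [← map_add]
        exact hdiff _ _ (by rw [smul_add, hpre, hpre, hpre, Submodule.coe_add]))
    obtain ⟨z, hz⟩ := CharacterModule.dual_surjective_of_injective
      (LinearMap.range (LinearMap.lsmul Λ M r)).subtype (Submodule.injective_subtype _) y'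
    refine ⟨z, ?_⟩
    ext m
    rw [LinearMap.lsmul_apply, CharacterModule.smul_apply]
    have h1 : z (r • m) = y' ⟨r • m, (mem_range_lsmul_iff r _).mpr ⟨m, rfl⟩⟩ :=
      DFunLike.congr_fun hz ⟨r • m, (mem_range_lsmul_iff r _).mpr ⟨m, rfl⟩⟩
    rw [h1]
    exact hdiff _ _ (hpre _)

/-- **`t` is a non-zero-divisor on `M̂` when `M` is `t`-divisible** (`y(m) = y(t m') = (t • y)(m') = 0`).
[cite: Greenberg2016Selmer, §1 p. 2 L17–35] -/
theorem smul_characterModule_eq_zero_imp_of_divisible {M : Type u} [AddCommGroup M] [Module Λ M] {t : Λ}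
    (hdiv : ∀ m : M, ∃ m' : M, t • m' = m) : ∀ y : CharacterModule M, t • y = 0 → y = 0 := by
  intro y hy
  ext m
  obtain ⟨m', rfl⟩ := hdiv m
  have := DFunLike.congr_fun hy m'
  rwa [CharacterModule.smul_apply] at this

/-- **`t` is a non-zero-divisor on `M̂ / r M̂` when `M[r]` is `t`-divisible**: if `t • y ∈ r M̂` then `y` kills
`M[r] = t · M[r]`, so `y ∈ r M̂` (`mem_range_lsmul_characterModule_iff`). [cite: Greenberg2006, p. 350 L25–36] -/
theorem mem_range_lsmul_of_smul_mem_of_torsion_divisible {M : Type u} [AddCommGroup M] [Module Λ M]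
    {t r : Λ} (hdiv : ∀ m : M, r • m = 0 → ∃ m' : M, r • m' = 0 ∧ t • m' = m) :
    ∀ y : CharacterModule M, t • y ∈ LinearMap.range (LinearMap.lsmul Λ (CharacterModule M) r) →
      y ∈ LinearMap.range (LinearMap.lsmul Λ (CharacterModule M) r) := by
  intro y hy
  rw [mem_range_lsmul_characterModule_iff] at hy ⊢
  intro m hm
  obtain ⟨m', hm', rfl⟩ := hdiv m hm
  have := hy m' hm'
  rwa [CharacterModule.smul_apply] at this

end SmulCore

/-! ## §4 The Selmer-group instance (Greenberg's arena) -/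

section Selmer

variable {K : Type u} [Field K] [NumberField K] {S : Set (HeightOneSpectrum (𝓞 K))}
  {Λ : Type u} [CommRing Λ] [TopologicalSpace Λ]
  {D : Type u} [AddCommGroup D] [Module Λ D] [TopologicalSpace D] [DiscreteTopology D]
  [ContinuousSMul Λ D] {ρ : ContinuousRep (GaloisGroupUnramifiedOutside K S) Λ D}

/-- `𝓛' ≤ 𝓛` placewise on `Σ` ⟹ `S_{𝓛'}(K, 𝐃) ≤ S_𝓛(K, 𝐃)`. [cite: Greenberg2016Selmer, §1 p. 3 L26–32, Remark 3.1.2] -/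
theorem selmer_mono {L' L : Specification S ρ} (h : ∀ v : Place K, InSigma S v → L' v ≤ L v) :
    L'.selmer ≤ L.selmer := by
  intro c hc
  rw [Specification.mem_selmer_iff] at hc ⊢
  exact fun v ↦ h v.1 v.2 (hc v)

/-- `r • L(K_v, 𝐃) ⊆ L'(K_v, 𝐃)` for every `v ∈ Σ` ⟹ `r • S_𝓛(K, 𝐃) ⊆ S_{𝓛'}(K, 𝐃)` (the localisation maps are
`Λ`-linear). [cite: Greenberg2016Selmer, §1 p. 3 L26–32, §4.2 p. 19 L25–31] -/
theorem smul_mem_selmer_of_forall {L' L : Specification S ρ} (r : Λ)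
    (h : ∀ v : Place K, InSigma S v → ∀ c ∈ L v, r • c ∈ L' v) :
    ∀ c ∈ L.selmer, r • c ∈ L'.selmer := by
  intro c hc
  rw [Specification.mem_selmer_iff] at hc ⊢
  intro v
  rw [map_smul]
  exact h v.1 v.2 _ (hc v)

/-- **Route G′, Selmer level.** If `𝓛' ≤ 𝓛` and `r • 𝓛 ⊆ 𝓛'` placewise on `Σ`, and the core Selmer group
`S_{𝓛'}(K, 𝐃)` is almost divisible (the conclusion of Prop. 4.1.1 (c) for `𝓛'`), then in EVERY Pontryagin dual
of `S_𝓛(K, 𝐃)` every pseudo-null `Λ`-submodule is killed by `r`.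
[cite: Greenberg2016Selmer, Prop. 4.1.1 (c), Remark 3.1.2, §4.2 p. 19 L25–31] -/
theorem forall_isPseudoNull_smul_eq_zero_selmer_of_core {L' L : Specification S ρ}
    (hle : ∀ v : Place K, InSigma S v → L' v ≤ L v) {r : Λ}
    (hr : ∀ v : Place K, InSigma S v → ∀ c ∈ L v, r • c ∈ L' v)
    (hS' : IsAlmostDivisible Λ ↥L'.selmer) {X : Type u} [AddCommGroup X] [Module Λ X]
    {toDual : X →+ (↥L.selmer →+ AddCircle (1 : ℚ))} (hX : IsDualPairing Λ ↥L.selmer toDual) :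
    ∀ P : Submodule Λ X, Module.IsPseudoNull Λ ↥P → ∀ x ∈ P, r • x = 0 :=
  forall_isPseudoNull_smul_eq_zero_of_le (selmer_mono hle) (smul_mem_selmer_of_forall r hr) hS' hX

/-- The tolerant (`∃ m`) shape with `r = c ^ a`. [cite: Greenberg2016Selmer, Prop. 4.1.1 (c), Remark 3.1.2] -/
theorem forall_isPseudoNull_exists_pow_smul_eq_zero_selmer_of_core {L' L : Specification S ρ}
    (hle : ∀ v : Place K, InSigma S v → L' v ≤ L v) (c : Λ) (a : ℕ)
    (hr : ∀ v : Place K, InSigma S v → ∀ x ∈ L v, c ^ a • x ∈ L' v)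
    (hS' : IsAlmostDivisible Λ ↥L'.selmer) {X : Type u} [AddCommGroup X] [Module Λ X]
    {toDual : X →+ (↥L.selmer →+ AddCircle (1 : ℚ))} (hX : IsDualPairing Λ ↥L.selmer toDual) :
    ∀ P : Submodule Λ X, Module.IsPseudoNull Λ ↥P → ∃ m : ℕ, ∀ x ∈ P, c ^ m • x = 0 :=
  fun P hP ↦ ⟨a, forall_isPseudoNull_smul_eq_zero_selmer_of_core hle hr hS' hX P hP⟩

end Selmer

end Summit.BirchSwinnertonDyer.BirchSwinnertonDyer.Theorems.TelescopeK2PurityTolerantOfCore
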